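import Summits.ResolutionOfSingularities.ResolutionOfSingularities.Theorems.HomologicalConductorNoZenoStrictTransformM
import Summits.ResolutionOfSingularities.ResolutionOfSingularities.Theorems.MarkedTransferCampaignW46FiniteExitBoundNodes
import Summits.ResolutionOfSingularities.ResolutionOfSingularities.Theorems.EquisingularLiftEquisingularLiftNatCentreCartierPairFrame
import Literature.AlgebraicGeometry.Resolution.QuadraticTransformsKeyLemma
import Literature.AlgebraicGeometry.Resolution.StalkIdealLemmas
import Literature.AlgebraicGeometry.Resolution.PermissibleCentres
import Literature.AlgebraicGeometry.Resolution.MarkedIdealsLemmas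
import Literature.AlgebraicGeometry.Resolution.Blowups
import HarnessLib

/-!
# Crux `NoZenoR` (stmt-ResolutionOfSingularities-19943) — toward the first-kind clause (F) / factorisation of proper
# birational morphisms of regular surfaces (Stacks 0C5R): the ONE-STEP FACTORISATION through a point blow-up

Route `ResolutionOfSingularities/HomologicalConductor` (cell decomp-res, hand leafhand-res-homologicalconduct-18 g0).
OURS: AI-written proof over tree theorems, weaker than expert review; nothing here is a statement of the manuscript
under review (Hironaka 2017).  SUPPORT level, counted 0.  Def-free, no new named facts.

The remaining print content of Lipman (27.3) «⇐» is the clause (F) «a non-isomorphic morphism between desingularizations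
contracts a first-kind curve» (hand 7, `…NoZenoMinimalityCriterionResidual`), i.e. Zariski's factorisation of proper
birational morphisms of regular surfaces into point blow-ups.  Its local step is proved here:

* `isPrincipal_map_maximalIdeal_stalkMap_of_not_surjective` — for a birational dominant `u : X → Y` of integral schemes,
  a point `x` with `𝒪_{Y,u x}` and `𝒪_{X,x}` regular of dimension `2` and `u♯_x` NOT surjective (the two local rings
  differ inside `K(X)`), the extended ideal `𝔪_{u x}·𝒪_{X,x}` is PRINCIPAL — Abhyankar / Huneke–Swanson 14.5.2 «crucial
  point» (tree `exists_rsop_div_mem_of_ne`: `𝔪_R = (a, b)` with `b/a ∈ 𝒪_{X,x}`) read through the dictionary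
  `𝒪 ↪ K(X)` (`RatFn.toFunctionField`, `functionFieldMap`);
* `isEffectiveCartier_comap_vanishingIdeal_of_forall_not_surjective` — hence, if NO point of the fibre `u⁻¹(y)` of a
  closed point `y` (all relevant local rings regular of dimension `2`) has surjective `u♯`, the ideal `𝔪_y·𝒪_X` is an
  effective Cartier divisor, and
* `exists_fac_blowup_point_of_forall_not_surjective` — `u` FACTORS through the blowing up of `Y` at `y`
  (`IsBlowup.lift`).

No crux or summit statement is proved here.
-/

noncomputable section

-- single-problem summit: the doubled namespace component `ResolutionOfSingularities` is forced
set_option linter.dupNamespace false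

open CategoryTheory AlgebraicGeometry TopologicalSpace IsLocalRing
open Literature.AlgebraicGeometry.Resolution Literature.AlgebraicGeometry.Motives
open Literature.AlgebraicGeometry.Motives.RatFn
open Summit.ResolutionOfSingularities.ResolutionOfSingularities.Theorems.CampaignW46
open Summit.ResolutionOfSingularities.ResolutionOfSingularities.Theorems.NoZeno.ExcCount
open Scheme.IdealSheafData

universe u

namespace Summit.ResolutionOfSingularities.ResolutionOfSingularities.Theorems.NoZeno.Lipman12B

variable {X Y : Scheme.{u}} [IsIntegral X] [IsIntegral Y] (u : X ⟶ Y) [IsDominant u]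

/-- **`𝔪_{u x}·𝒪_{X,x}` is principal when `𝒪_{Y,u x} ⊊ 𝒪_{X,x}` are two-dimensional regular local rings of `K(X)`**
(`u` birational dominant between integral schemes, `u♯_x` not surjective): there is `t ∈ 𝔪_{u x}` with
`𝔪_{u x}·𝒪_{X,x} = u♯_x(t)·𝒪_{X,x}`. [cite: HunekeSwanson2006, Thm. 14.5.2 (proof, "the crucial point")];
[cite: Abhyankar1956Valuations, Thm. 3] -/
theorem isPrincipal_map_maximalIdeal_stalkMap_of_not_surjective (hu : IsBirational u) (x : X)
    [IsRegularLocalRing (Y.presheaf.stalk (u.base x))] [IsRegularLocalRing (X.presheaf.stalk x)]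
    (hy2 : ringKrullDim (Y.presheaf.stalk (u.base x)) = 2) (hx2 : ringKrullDim (X.presheaf.stalk x) = 2)
    (hns : ¬ Function.Surjective (u.stalkMap x)) :
    ∃ t : Y.presheaf.stalk (u.base x), t ∈ maximalIdeal (Y.presheaf.stalk (u.base x)) ∧
      (maximalIdeal (Y.presheaf.stalk (u.base x))).map (u.stalkMap x).hom =
        Ideal.span {(u.stalkMap x).hom t} := by
  classical
  -- the dictionary: `R = 𝒪_{Y,u x} ⊆ T = 𝒪_{X,x}` inside `K(X)`
  set φ : Y.presheaf.stalk (u.base x) →+* X.functionField := (toFunctionField x).comp (u.stalkMap x).hom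
    with hφdef
  have hφ : ∀ a, φ a = toFunctionField x ((u.stalkMap x).hom a) := fun a => rfl
  have hφinj : Function.Injective φ :=
    (toFunctionField_injective x).comp (stalkMap_injective_of_isDominant u x)
  set R : Subring X.functionField := φ.range with hRdef
  set T : Subring X.functionField := (toFunctionField x).range with hTdef
  let eR : Y.presheaf.stalk (u.base x) ≃+* R :=
    RingEquiv.ofBijective φ.rangeRestrict ⟨fun _ _ h => hφinj (congrArg Subtype.val h), φ.rangeRestrict_surjective⟩
  have heR : ∀ a, ((eR a : R) : X.functionField) = φ a := fun a => rfl
  haveI hR : IsRegularLocalRing R := IsRegularLocalRing.of_ringEquiv eR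
  have hRdim : ringKrullDim R = 2 := (ringKrullDim_eq_of_ringEquiv eR).symm.trans hy2
  haveI hT : IsRegularLocalRing T := isRegularLocalRing_range_of x
  have hTdim : ringKrullDim T = 2 := by rw [hTdef, ringKrullDim_range_algebraMap_stalk]; exact hx2
  -- `R` is a local ring OF `K(X)` (birationality: `K(Y) = Frac 𝒪_{Y,u x} → K(X)` is onto)
  have hRK : IsLocalRingOf R := by
    refine ⟨inferInstance, fun z => ?_⟩
    obtain ⟨k, hk⟩ := functionFieldMap_surjective_of_isBirational u hu z
    obtain ⟨a, b, hb, hab⟩ := IsFractionRing.div_surjective (A := Y.presheaf.stalk (u.base x)) k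
    refine ⟨φ a, ⟨a, rfl⟩, φ b, ⟨b, rfl⟩, ?_, ?_⟩
    · exact (map_ne_zero_iff φ hφinj).mpr (nonZeroDivisors.ne_zero hb)
    · rw [← hk, ← hab, map_div₀, hφ, hφ, ← functionFieldMap_toFunctionField, ← functionFieldMap_toFunctionField]
  -- `T` dominates `R`
  have hdom : SubringDominates R T := by
    refine ⟨?_, fun r hr hrT => ?_⟩
    · rintro _ ⟨a, rfl⟩
      exact ⟨(u.stalkMap x).hom a, (hφ a).symm⟩
    · obtain ⟨a, rfl⟩ := hr
      obtain ⟨s, hs⟩ := hrT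
      by_cases ha0 : φ a = 0
      · rw [ha0, inv_zero]; exact R.zero_mem
      have hunit : IsUnit ((u.stalkMap x).hom a) := by
        refine IsUnit.of_mul_eq_one s (toFunctionField_injective x ?_)
        rw [map_mul, map_one, ← hφ, hs, mul_inv_cancel₀ ha0]
      have hua : IsUnit a := (isUnit_map_iff (u.stalkMap x).hom a).mp hunit
      obtain ⟨v, hv⟩ := hua.exists_right_inv
      refine ⟨v, ?_⟩
      have : φ a * φ v = 1 := by rw [← map_mul, hv, map_one]
      exact (eq_inv_of_mul_eq_one_right this).symm ▸ rfl
  -- `R ≠ T` since `u♯_x` is not onto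
  have hne : R ≠ T := by
    intro hRT
    apply hns
    intro s
    have hs : toFunctionField x s ∈ R := hRT ▸ ⟨s, rfl⟩
    obtain ⟨a, ha⟩ := hs
    exact ⟨a, toFunctionField_injective x (by rw [← hφ]; exact ha)⟩
  -- the key lemma: `𝔪_R = (a, b)` with `b / a ∈ T`
  obtain ⟨a, b, hm, ha0, -, hba⟩ := exists_rsop_div_mem_of_ne hR hRdim hRK hT hTdim hdom hne
  obtain ⟨s, hs⟩ := hba
  -- pull `a` back to `𝒪_{Y,u x}`
  set a₀ := eR.symm a with ha₀
  have ha₀' : eR a₀ = a := eR.apply_symm_apply a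
  have hφa₀ : φ a₀ = (a : X.functionField) := by rw [← heR, ha₀']
  -- membership in the maximal ideals is matched by `eR` (units correspond)
  have hmem : ∀ c, c ∈ maximalIdeal (Y.presheaf.stalk (u.base x)) ↔ (eR c : R) ∈ maximalIdeal R := fun c => by
    rw [IsLocalRing.mem_maximalIdeal, IsLocalRing.mem_maximalIdeal, mem_nonunits_iff, mem_nonunits_iff,
      not_iff_not]
    exact ⟨fun h => h.map eR, fun h => by simpa using h.map eR.symm⟩
  have haR : (a : R) ∈ maximalIdeal R := by
    rw [hm]; exact Ideal.subset_span (Set.mem_insert _ _)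
  have ha₀m : a₀ ∈ maximalIdeal (Y.presheaf.stalk (u.base x)) := (hmem a₀).mpr (by rw [ha₀']; exact haR)
  refine ⟨a₀, ha₀m, le_antisymm ?_ ?_⟩
  · -- `⊆`: every `m ∈ 𝔪` maps into `(u♯ a₀)`
    rw [Ideal.map_le_iff_le_comap]
    intro m hm'
    have hmR : (eR m : R) ∈ maximalIdeal R := (hmem m).mp hm'
    rw [hm, Ideal.mem_span_pair] at hmR
    obtain ⟨p, q, hpq⟩ := hmR
    -- in `K(X)`: `φ m = (p + q · (b/a)) · a`
    have hK : φ m = ((p : X.functionField) + (q : X.functionField) * (((b : R) : X.functionField) /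
        ((a : R) : X.functionField))) * ((a : R) : X.functionField) := by
      have := congrArg (fun r : R => (r : X.functionField)) hpq
      simp only [Subring.coe_add, Subring.coe_mul] at this
      rw [← heR m, ← this]
      have ha0' : ((a : R) : X.functionField) ≠ 0 := fun h => ha0 (Subtype.ext h)
      field_simp
    -- the coefficient lies in `T`
    have hcoef : (p : X.functionField) + (q : X.functionField) * (((b : R) : X.functionField) /
        ((a : R) : X.functionField)) ∈ T :=
      T.add_mem (hdom.1 p.2) (T.mul_mem (hdom.1 q.2) ⟨s, hs⟩)
    obtain ⟨c, hc⟩ := hcoef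
    rw [Ideal.mem_comap, Ideal.mem_span_singleton']
    refine ⟨c, toFunctionField_injective x ?_⟩
    rw [map_mul, ← hφ, ← hφ, hφa₀, hc, hK]
  · -- `⊇`
    rw [Ideal.span_singleton_le_iff_mem]
    exact Ideal.mem_map_of_mem _ ha₀m

/-- **`𝔪_y·𝒪_X` is an effective Cartier divisor when no point of the fibre `u⁻¹(y)` has the local ring of `y`**: for
`u : X → Y` birational dominant between integral schemes, `X` locally Noetherian, `y` a closed point with `𝒪_{Y,y}` regular
of dimension `2`, every point over `y` having a regular two-dimensional local ring and a NON-surjective `u♯`, and the fibre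
non-empty in the sense `𝔪_y·𝒪_X ≠ 0` — then `𝔪_y·𝒪_X` is invertible (stalkwise principal by
`isPrincipal_map_maximalIdeal_stalkMap_of_not_surjective`, the unit ideal off the fibre).
[cite: StacksProject, Tag 0C5H]; [cite: HunekeSwanson2006, Thm. 14.5.2] -/
theorem isEffectiveCartier_comap_vanishingIdeal_of_forall_not_surjective [IsLocallyNoetherian X]
    (hu : IsBirational u) {y : Y} (hy : IsClosed ({y} : Set Y)) [IsRegularLocalRing (Y.presheaf.stalk y)]
    (hy2 : ringKrullDim (Y.presheaf.stalk y) = 2)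
    (hX : ∀ x : X, u.base x = y → IsRegularLocalRing (X.presheaf.stalk x) ∧ ringKrullDim (X.presheaf.stalk x) = 2)
    (hns : ∀ x : X, u.base x = y → ¬ Function.Surjective (u.stalkMap x))
    (hne : (vanishingIdeal ⟨{y}, hy⟩).comap u ≠ ⊥) :
    IsEffectiveCartier ((vanishingIdeal ⟨{y}, hy⟩).comap u) := by
  refine Summit.ResolutionOfSingularities.ResolutionOfSingularities.Cruxes.EquisingularLiftNat.Sections.isEffectiveCartier_of_isPrincipal_stalkIdeal_of_ne_bot
    (fun z => ?_) hne
  rw [stalkIdeal_comap_eq_map_stalkMap]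
  by_cases hz : u.base z = y
  · subst hz
    obtain ⟨hreg, hz2⟩ := hX z rfl
    haveI := hreg
    obtain ⟨t, -, ht⟩ := isPrincipal_map_maximalIdeal_stalkMap_of_not_surjective u hu z hy2 hz2 (hns z rfl)
    rw [stalkIdeal_vanishingIdeal_singleton hy, ht]
    exact ⟨⟨_, rfl⟩⟩
  · -- off the fibre the centre is the unit ideal
    have hz' : u.base z ∉ (vanishingIdeal (⟨{y}, hy⟩ : Closeds Y)).support := by
      rw [← SetLike.mem_coe, Scheme.IdealSheafData.coe_support_vanishingIdeal]
      exact hz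
    rw [stalkIdeal_eq_top_of_not_mem_support hz', Ideal.map_top]
    exact ⟨⟨1, by simp⟩⟩

/-- **One-step factorisation through the point blow-up** (the local step of Stacks Tag 0C5R): under the hypotheses of
`isEffectiveCartier_comap_vanishingIdeal_of_forall_not_surjective`, `u` factors through every blowing up
`b : Y' → Y` of `Y` at `y` — `u = u' ≫ b` (`IsBlowup.lift`). [cite: StacksProject, Tag 0C5H] -/
theorem exists_fac_blowup_point_of_forall_not_surjective [IsLocallyNoetherian X]
    (hu : IsBirational u) {y : Y} (hy : IsClosed ({y} : Set Y)) [IsRegularLocalRing (Y.presheaf.stalk y)]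
    (hy2 : ringKrullDim (Y.presheaf.stalk y) = 2)
    (hX : ∀ x : X, u.base x = y → IsRegularLocalRing (X.presheaf.stalk x) ∧ ringKrullDim (X.presheaf.stalk x) = 2)
    (hns : ∀ x : X, u.base x = y → ¬ Function.Surjective (u.stalkMap x))
    (hne : (vanishingIdeal ⟨{y}, hy⟩).comap u ≠ ⊥)
    {Y' : Scheme.{u}} {b : Y' ⟶ Y} (hb : IsBlowup b (vanishingIdeal ⟨{y}, hy⟩)) :
    ∃ u' : X ⟶ Y', u' ≫ b = u :=
  ⟨hb.lift u (isEffectiveCartier_comap_vanishingIdeal_of_forall_not_surjective u hu hy hy2 hX hns hne),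
    hb.lift_comp u _⟩

end Summit.ResolutionOfSingularities.ResolutionOfSingularities.Theorems.NoZeno.Lipman12B

end
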